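import Summits.MatrixMultiplication.OmegaCensus.STPPVosperSlackOneLawCard2
import Summits.MatrixMultiplication.OmegaCensus.STPPVosperSlackOneKillsZ61B
import Summits.MatrixMultiplication.OmegaCensus.STPPVosperSlackOneKillsZ61C
import Summits.MatrixMultiplication.OmegaCensus.STPPVosperSlackOneKillsB2Z61
import Summits.MatrixMultiplication.OmegaCensus.STPP222SqSymmetry
import Summits.MatrixMultiplication.OmegaCensus.STPPDisjointPacking

/-!
# ω-census (abelian STPP census): the g30 `ℤ₆₁` kills restated with the Hamidoune–Rødseth hypothesis restricted to `|S| ∈ {3, 4}` (kernel)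

HONEST FRAMING (pub-omega census; verbatim): lottery ticket; floor = certified bounds/negative ranges.
Census STRUCTURE (seat pub-omega-stpp-1 gen 30, 2026-08-28), family (b2).  Bookkeeping companions of the `…_of_hamidouneRodseth` kills: the same leaves, same
readings and tables, but the hypothesis is `HamidouneRodsethCard 3` and/or `HamidouneRodsethCard 4` (the published theorem for three- resp. four-element sets `S`
only; `STPPVosperSlackOneLawCard.lean`).  So the census can record per leaf that Hamidoune–Rødseth for `|S| = 3` (resp. `4`) is the exact upstream item.  Still
CONDITIONAL; nothing here is progress on `ω`. (The three `(3,3,2)`-block leaves are already restated `_of_hrCard3` in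
`STPPVosperSlackOneLawCard.lean`.)

References: Y. O. Hamidoune, Ø. J. Rødseth, Acta Arith. 92 (2000) 251–262; A. G. Vosper, J. London Math. Soc. 31 (1956); M. B. Nathanson, GTM 165,
Thm 2.7; H. Cohn, R. Kleinberg, B. Szegedy, C. Umans, FOCS 2005 (arXiv:math/0511460), Def. 5.1.
-/

open Finset
open scoped Pointwise

namespace Summit.MatrixMultiplication.OmegaCensus.CubeNB

open Literature.Computability.AlgebraicComplexity
open Literature.Combinatorics.Additive
open Summit.MatrixMultiplication.OmegaCensus.STPPKneser

section Kills

/-- **`{(1,1,2),(2,3,3),(3,3,2),(3,4,2)}` has no STPP family in `ℤ₆₁`, PROVIDED the Hamidoune–Rødseth theorem for the stated cardinalities only** (enlarged-target slack-1 law,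
reading `(a,b,c)`, block `(3,4,2)`: `(z, b, vol, a, L) = (14, 4, 24, 3, 17)`, tables `(43,19,4)`, α `(44,21,4)`, β `(44,19,4)`, target `{0, ±1, ±2, ±3, ±2⁻¹}`).
[cite: CohnKleinbergSzegedyUmans2005, Def. 5.1] [cite: HamidouneRodseth2000, main theorem (§1, p. 252)] [cite: Nathanson1996, Thm 2.7] -/
theorem no_isSTPP_zmod61_112_233_332_342_of_hrCard34 (h3 : HamidouneRodsethCard 3) (h4 : HamidouneRodsethCard 4)
    (A B C : Fin 4 → Finset (ZMod 61)) (hS : IsSTPP A B C)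
    (hA : ∀ i, #(A i) = ![1, 2, 3, 3] i) (hB : ∀ i, #(B i) = ![1, 3, 3, 4] i) (hC : ∀ i, #(C i) = ![2, 3, 2, 2] i) :
    False := by
  haveI : Fact (Nat.Prime 61) := ⟨prime_61⟩
  have hAne : ∀ i, (A i).Nonempty := fun i => card_pos.1 (by rw [hA]; fin_cases i <;> simp)
  have hBne : ∀ i, (B i).Nonempty := fun i => card_pos.1 (by rw [hB]; fin_cases i <;> simp)
  have hCne : ∀ i, (C i).Nonempty := fun i => card_pos.1 (by rw [hC]; fin_cases i <;> simp)
  have e3 : (univ : Finset (Fin 4)).erase 3 = {0, 1, 2} := by decide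
  have hz : ∑ k ∈ (univ : Finset (Fin 4)).erase 3, #(A k) * #(C k) = 14 := by
    rw [e3]; simp [Finset.sum_insert, hA, hC]
  have hL : ∑ k ∈ (univ : Finset (Fin 4)).erase 3, #(B k) * #(C k) = 17 := by
    rw [e3]; simp [Finset.sum_insert, hB, hC]
  have ha : #(A 3) = 3 := by rw [hA]; simp
  have hb : #(B 3) = 4 := by rw [hB]; simp
  have hvol : #(A 3) * #(B 3) * #(C 3) = 24 := by rw [hA, hB, hC]; simp
  exact no_isSTPP_of_slack_one_tables_prime_card h3 h4 A B C hS hAne hBne hCne 3 ⟨0, by decide⟩ ha hb hvol hz hL (by norm_num) (by norm_num)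
    (by norm_num) (by norm_num) (by norm_num) (m := 19) (n := 43) rfl rfl target_61_a3_b4 table_43_19_4_mult tableAlpha_61_44_21_4_mult
    tableBeta_61_44_19_4_mult

/-- **`{(2,2,4),(3,4,2),(3,4,2)}` has no STPP family in `ℤ₆₁`, PROVIDED the Hamidoune–Rødseth theorem for the stated cardinalities only** (`a = 2` slack-1 law in the reading
`(a,c,b)`, i.e. for the STPP family `(−A,−C,−B)` (`isSTPP_negSwap`), block `(2,4,2)`: `(z, b, vol, a, L) = (24, 4, 16, 2, 16)`).
[cite: CohnKleinbergSzegedyUmans2005, Def. 5.1] [cite: HamidouneRodseth2000, main theorem (§1, p. 252)] [cite: Nathanson1996, Thm 2.7] -/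
theorem no_isSTPP_zmod61_224_342_342_of_hrCard4 (h4 : HamidouneRodsethCard 4)
    (A B C : Fin 3 → Finset (ZMod 61)) (hS : IsSTPP A B C)
    (hA : ∀ i, #(A i) = ![2, 3, 3] i) (hB : ∀ i, #(B i) = ![2, 4, 4] i) (hC : ∀ i, #(C i) = ![4, 2, 2] i) :
    False := by
  haveI : Fact (Nat.Prime 61) := ⟨prime_61⟩
  have hAne : ∀ i, (A i).Nonempty := fun i => card_pos.1 (by rw [hA]; fin_cases i <;> simp)
  have hBne : ∀ i, (B i).Nonempty := fun i => card_pos.1 (by rw [hB]; fin_cases i <;> simp)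
  have hCne : ∀ i, (C i).Nonempty := fun i => card_pos.1 (by rw [hC]; fin_cases i <;> simp)
  -- the family (−A, −C, −B)
  set A' : Fin 3 → Finset (ZMod 61) := fun t => (A t).image Neg.neg with hA'
  set B' : Fin 3 → Finset (ZMod 61) := fun t => (C t).image Neg.neg with hB'
  set C' : Fin 3 → Finset (ZMod 61) := fun t => (B t).image Neg.neg with hC'
  have hS' : IsSTPP A' B' C' := STPP222SqNeg.isSTPP_negSwap hS
  have hcA' : ∀ t, #(A' t) = #(A t) := fun t => Finset.card_image_of_injective _ neg_injective
  have hcB' : ∀ t, #(B' t) = #(C t) := fun t => Finset.card_image_of_injective _ neg_injective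
  have hcC' : ∀ t, #(C' t) = #(B t) := fun t => Finset.card_image_of_injective _ neg_injective
  have hAne' : ∀ t, (A' t).Nonempty := fun t => (hAne t).image _
  have hBne' : ∀ t, (B' t).Nonempty := fun t => (hCne t).image _
  have hCne' : ∀ t, (C' t).Nonempty := fun t => (hBne t).image _
  have e0 : (univ : Finset (Fin 3)).erase 0 = {1, 2} := by decide
  have hz : ∑ k ∈ (univ : Finset (Fin 3)).erase 0, #(A' k) * #(C' k) = 24 := by
    rw [e0, Finset.sum_pair (by decide)]; simp [hcA', hcC', hA, hB]
  have hL : ∑ k ∈ (univ : Finset (Fin 3)).erase 0, #(B' k) * #(C' k) = 16 := by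
    rw [e0, Finset.sum_pair (by decide)]; simp [hcB', hcC', hC, hB]
  have ha : #(A' 0) = 2 := by rw [hcA', hA]; simp
  have hb : #(B' 0) = 4 := by rw [hcB', hC]; simp
  have hvol : #(A' 0) * #(B' 0) * #(C' 0) = 16 := by rw [hcA', hcB', hcC', hA, hB, hC]; simp
  exact no_isSTPP_of_slack_one_tables_prime_a2_card h4 A' B' C' hS' hAne' hBne' hCne' 0 ⟨1, by decide⟩ ha hb hvol hz hL rfl (by norm_num)
    (by norm_num) (by norm_num) (by norm_num) (m := 17) (n := 33) rfl rfl target_61_a2_b4 table_33_17_4_a2b4 tableAlpha2_61_34_16_4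
    tableBeta_61_34_17_4_a2b4

/-- **`{(2,2,4),(4,3,2),(4,3,2)}` has no STPP family in `ℤ₆₁`, PROVIDED the Hamidoune–Rødseth theorem for the stated cardinalities only** (`a = 2` slack-1 law in the reading
`(b,c,a)`, i.e. for the STPP family `(B,C,A)` (`stpp_rotate`), block `(2,4,2)`: `(z, b, vol, a, L) = (24, 4, 16, 2, 16)`).
[cite: CohnKleinbergSzegedyUmans2005, Def. 5.1] [cite: HamidouneRodseth2000, main theorem (§1, p. 252)] [cite: Nathanson1996, Thm 2.7] -/
theorem no_isSTPP_zmod61_224_432_432_of_hrCard4 (h4 : HamidouneRodsethCard 4)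
    (A B C : Fin 3 → Finset (ZMod 61)) (hS : IsSTPP A B C)
    (hA : ∀ i, #(A i) = ![2, 4, 4] i) (hB : ∀ i, #(B i) = ![2, 3, 3] i) (hC : ∀ i, #(C i) = ![4, 2, 2] i) :
    False := by
  haveI : Fact (Nat.Prime 61) := ⟨prime_61⟩
  have hS' : IsSTPP B C A := stpp_rotate hS
  have hAne : ∀ i, (A i).Nonempty := fun i => card_pos.1 (by rw [hA]; fin_cases i <;> simp)
  have hBne : ∀ i, (B i).Nonempty := fun i => card_pos.1 (by rw [hB]; fin_cases i <;> simp)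
  have hCne : ∀ i, (C i).Nonempty := fun i => card_pos.1 (by rw [hC]; fin_cases i <;> simp)
  have e0 : (univ : Finset (Fin 3)).erase 0 = {1, 2} := by decide
  have hz : ∑ k ∈ (univ : Finset (Fin 3)).erase 0, #(B k) * #(A k) = 24 := by
    rw [e0, Finset.sum_pair (by decide)]; simp [hA, hB]
  have hL : ∑ k ∈ (univ : Finset (Fin 3)).erase 0, #(C k) * #(A k) = 16 := by
    rw [e0, Finset.sum_pair (by decide)]; simp [hA, hC]
  have ha : #(B 0) = 2 := by rw [hB]; simp
  have hb : #(C 0) = 4 := by rw [hC]; simp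
  have hvol : #(B 0) * #(C 0) * #(A 0) = 16 := by rw [hA, hB, hC]; simp
  exact no_isSTPP_of_slack_one_tables_prime_a2_card h4 B C A hS' hBne hCne hAne 0 ⟨1, by decide⟩ ha hb hvol hz hL rfl (by norm_num)
    (by norm_num) (by norm_num) (by norm_num) (m := 17) (n := 33) rfl rfl target_61_a2_b4 table_33_17_4_a2b4 tableAlpha2_61_34_16_4
    tableBeta_61_34_17_4_a2b4

/-- **`{(1,1,2),(2,3,2),(4,2,3),(4,2,3)}` has no STPP family in `ℤ₆₁`, PROVIDED the Hamidoune–Rødseth theorem for the stated cardinalities only** (`b = 2` slack-1 law, reading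
`(a,b,c)`, block `(4,2,3)`: `(z, b, vol, a, L) = (18, 2, 24, 4, 14)`).
[cite: CohnKleinbergSzegedyUmans2005, Def. 5.1] [cite: HamidouneRodseth2000, main theorem (§1, p. 252)] [cite: Nathanson1996, Thm 2.7] -/
theorem no_isSTPP_zmod61_112_232_423_423_of_hrCard4 (h4 : HamidouneRodsethCard 4)
    (A B C : Fin 4 → Finset (ZMod 61)) (hS : IsSTPP A B C)
    (hA : ∀ i, #(A i) = ![1, 2, 4, 4] i) (hB : ∀ i, #(B i) = ![1, 3, 2, 2] i) (hC : ∀ i, #(C i) = ![2, 2, 3, 3] i) :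
    False := by
  haveI : Fact (Nat.Prime 61) := ⟨prime_61⟩
  have hAne : ∀ i, (A i).Nonempty := fun i => card_pos.1 (by rw [hA]; fin_cases i <;> simp)
  have hBne : ∀ i, (B i).Nonempty := fun i => card_pos.1 (by rw [hB]; fin_cases i <;> simp)
  have hCne : ∀ i, (C i).Nonempty := fun i => card_pos.1 (by rw [hC]; fin_cases i <;> simp)
  have e2 : (univ : Finset (Fin 4)).erase 2 = {0, 1, 3} := by decide
  have hz : ∑ k ∈ (univ : Finset (Fin 4)).erase 2, #(A k) * #(C k) = 18 := by
    rw [e2]; simp [Finset.sum_insert, hA, hC]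
  have hL : ∑ k ∈ (univ : Finset (Fin 4)).erase 2, #(B k) * #(C k) = 14 := by
    rw [e2]; simp [Finset.sum_insert, hB, hC]
  have ha : #(A 2) = 4 := by rw [hA]; simp
  have hb : #(B 2) = 2 := by rw [hB]; simp
  have hvol : #(A 2) * #(B 2) * #(C 2) = 24 := by rw [hA, hB, hC]; simp
  exact no_isSTPP_of_slack_one_tables_prime_b2_card h4 A B C hS hAne hBne hCne 2 ⟨0, by decide⟩ ha hb hvol hz hL (by norm_num) rfl
    (by norm_num) (by norm_num) (by norm_num) (m := 17) (n := 41) rfl rfl target_61_a4_b2 table_41_17_2_a4b2 tableAlpha_61_42_19_2_a4b2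
    tableBeta2_61_41_17

end Kills

end Summit.MatrixMultiplication.OmegaCensus.CubeNB
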